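import Literature.Analysis.FluidPDE.QuasiSelfSimilarTimeGluing
import Mathlib.MeasureTheory.Integral.IntervalIntegral.FundThmCalculus
import Mathlib.Analysis.Calculus.ContDiff.Deriv
import Mathlib.Analysis.Calculus.Deriv.MeanValue
import HarnessLib

/-!
# Smooth steps, ramps and plateaus with exact plateau data (profile algebra)

Topic `Literature/Analysis/FluidPDE`. The explicit moves of the planar pullback calculus
(`PlanarPullbackKinematics.lean`, `PlanarGraphBandKinematics.lean`) are fed with one-dimensional
profiles — displacement profiles `T(t,·)`, material reparametrisations `Ξ(t,·)`, cut-offs,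
clocks — which have to be smooth AND exactly known off their transition intervals (affine with
rational data), so that the identities between explicit maps required at `t = 1`
(self-similarity) and on the gate windows hold on the nose. This file provides that profile
algebra on top of the smooth step `Gluing.step` of `QuasiSelfSimilarTimeGluing.lean`
(`= 0` on `(-∞, 1/3]`, `= 1` on `[2/3, ∞)`):

* symmetry `step (1 - x) = 1 - step x` (`step_one_sub`, from the symmetry of
  `Real.smoothTransition`), monotonicity, `step (1/2) = 1/2`;
* the **ramp** `stepRamp x = ∫₀ˣ step`: smooth, nondecreasing, `stepRamp' = step ∈ [0,1]`, `stepRamp = 0` on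
  `(-∞, 1/3]` and — the point of the symmetric step — `stepRamp x = x - 1/2` EXACTLY on `[2/3, ∞)`
  (`stepRamp_of_ge`; the transition contributes `∫_{1/3}^{2/3} step = 1/6`);
* scaled/translated versions `rampAt a ρ` (`= 0` before `a + ρ/3`, `= x - a - ρ/2` after
  `a + 2ρ/3`), the **jog profile** `jogProfile a b ρ = rampAt a ρ - rampAt b ρ` (`0`, then slope
  `1`, then the constant `b - a`: the longitudinal profile of a born jog / K-bend), and the
  **plateau** cut-off `plateau a b ρ` (`= 1` on `[a + 2ρ/3, b - 2ρ/3]`, `= 0` off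
  `(a + ρ/3, b - ρ/3)`, values in `[0,1]`), all smooth with their exact values recorded.

Everything is elementary real analysis (folklore); the file states no named fact. It is
infrastructure towards a discharge of `acm_compatible_blocks`
(`QuasiSelfSimilarCompatibleBlocks.lean`).

## References

* G. Alberti, G. Crippa, A. L. Mazzucato, *Exponential self-similar mixing by incompressible
  flows*, J. Amer. Math. Soc. 32 (2019), 445–490, §8 (arXiv:1605.02090) — the construction these
  profiles serve.
-/

open Set Filter Topology MeasureTheory intervalIntegral

noncomputable section

namespace Literature.Analysis.FluidPDE.Gluing

/-! ## More on the smooth step -/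

/-- **Symmetry of the step** about `x = 1/2`: `step (1 - x) = 1 - step x`. [folklore] -/
theorem step_one_sub (x : ℝ) : step (1 - x) = 1 - step x := by
  -- symmetry of Mathlib's smooth transition: `smoothTransition y + smoothTransition (1 - y) = 1`
  -- (both are quotients of `expNegInvGlue`s over the same positive denominator; also recorded in
  -- `Literature.Topology.FourManifolds.RailNeck`, not imported here)
  have h : ∀ y : ℝ, Real.smoothTransition y + Real.smoothTransition (1 - y) = 1 := by
    intro y
    unfold Real.smoothTransition
    rw [sub_sub_cancel, add_comm (expNegInvGlue (1 - y)) (expNegInvGlue y), ← add_div,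
      div_self (Real.smoothTransition.pos_denom y).ne']
  have e : step (1 - x) = Real.smoothTransition (1 - (3 * x - 1)) := by
    unfold step; congr 1; ring
  rw [e]
  have hx := h (3 * x - 1)
  unfold step
  linarith

/-- The step is nondecreasing. [folklore] -/
theorem step_monotone : Monotone step := fun x y hxy =>
  Real.smoothTransition.monotone (by linarith)

/-- The value at the centre of symmetry: `step (1/2) = 1/2`. [folklore] -/
theorem step_half : step (1 / 2) = 1 / 2 := by
  have h := step_one_sub (1 / 2)
  norm_num at h
  linarith

/-- The step is continuous. [folklore] -/
theorem step_continuous : Continuous step := (step_contDiff (n := 0)).continuous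

/-! ## The ramp `∫₀ˣ step` -/

/-- **The ramp**: `stepRamp x = ∫₀ˣ step`, a smooth nondecreasing function with `stepRamp' = step`,
vanishing on `(-∞, 1/3]` and equal to `x - 1/2` on `[2/3, ∞)`. [folklore] -/
def stepRamp (x : ℝ) : ℝ := ∫ s in (0 : ℝ)..x, step s

/-- Unfolding the ramp. [folklore] -/
theorem stepRamp_def (x : ℝ) : stepRamp x = ∫ s in (0 : ℝ)..x, step s := rfl

/-- The step is interval integrable on every interval. [folklore] -/
theorem step_intervalIntegrable (a b : ℝ) : IntervalIntegrable step volume a b :=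
  step_continuous.intervalIntegrable a b

/-- **Fundamental theorem of calculus for the ramp**: `stepRamp' x = step x`. [folklore] -/
theorem hasDerivAt_stepRamp (x : ℝ) : HasDerivAt stepRamp (step x) x :=
  (step_continuous.integral_hasStrictDerivAt 0 x).hasDerivAt

/-- The derivative of the ramp is the step. [folklore] -/
theorem deriv_stepRamp : deriv stepRamp = step := funext fun x => (hasDerivAt_stepRamp x).deriv

/-- The ramp is differentiable. [folklore] -/
theorem stepRamp_differentiable : Differentiable ℝ stepRamp := fun x => (hasDerivAt_stepRamp x).differentiableAt

/-- **The ramp is smooth.** [folklore] -/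
theorem stepRamp_contDiff {n : ℕ∞} : ContDiff ℝ n stepRamp := by
  have h : ContDiff ℝ ((n : WithTop ℕ∞) + 1) stepRamp := by
    rw [contDiff_succ_iff_deriv]
    refine ⟨stepRamp_differentiable, fun hω => ?_, ?_⟩
    · exact absurd hω (by simp)
    · rw [deriv_stepRamp]; exact step_contDiff
  exact h.of_le le_self_add

/-- The ramp is continuous. [folklore] -/
theorem stepRamp_continuous : Continuous stepRamp := stepRamp_differentiable.continuous

/-- **The ramp vanishes on `(-∞, 1/3]`** (the step vanishes on `[min 0 x, max 0 x] ⊆ (-∞, 1/3]`).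
[folklore] -/
theorem stepRamp_of_le {x : ℝ} (hx : x ≤ 1 / 3) : stepRamp x = 0 := by
  rw [stepRamp_def]
  have h : ∀ s ∈ uIcc (0 : ℝ) x, step s = 0 := by
    intro s hs
    rw [mem_uIcc] at hs
    apply step_of_le
    rcases hs with ⟨_, h2⟩ | ⟨_, h2⟩ <;> linarith
  rw [integral_congr (g := fun _ => (0 : ℝ)) h, intervalIntegral.integral_zero]

/-- `stepRamp 0 = 0`. [folklore] -/
theorem stepRamp_zero : stepRamp 0 = 0 := stepRamp_of_le (by norm_num)

/-- **The transition integral**: `∫_{1/3}^{2/3} step = 1/6`, by the symmetry of the step.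
[folklore] -/
theorem integral_step_transition : ∫ s in (1 / 3 : ℝ)..(2 / 3), step s = 1 / 6 := by
  set I := ∫ s in (1 / 3 : ℝ)..(2 / 3), step s with hI
  -- substitute `s ↦ 1 - s`
  have h1 : ∫ s in (1 / 3 : ℝ)..(2 / 3), step (1 - s) = I := by
    rw [hI, intervalIntegral.integral_comp_sub_left (fun s => step s) 1]
    norm_num
  have h2 : ∫ s in (1 / 3 : ℝ)..(2 / 3), step (1 - s) = ∫ s in (1 / 3 : ℝ)..(2 / 3), (1 - step s) :=
    integral_congr fun s _ => step_one_sub s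
  have h3 : ∫ s in (1 / 3 : ℝ)..(2 / 3), (1 - step s) = (2 / 3 - 1 / 3) - I := by
    rw [intervalIntegral.integral_sub intervalIntegrable_const (step_intervalIntegrable _ _),
      intervalIntegral.integral_const, smul_eq_mul, mul_one]
  have : I = (2 / 3 - 1 / 3) - I := by rw [← h3, ← h2, h1]
  linarith

/-- **The ramp is exactly affine on `[2/3, ∞)`**: `stepRamp x = x - 1/2` for `x ≥ 2/3`
(`= 0 + 1/6 + (x - 2/3)`). [folklore] -/
theorem stepRamp_of_ge {x : ℝ} (hx : 2 / 3 ≤ x) : stepRamp x = x - 1 / 2 := by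
  rw [stepRamp_def]
  have hsplit1 : ∫ s in (0 : ℝ)..x, step s =
      (∫ s in (0 : ℝ)..(1 / 3), step s) + ∫ s in (1 / 3 : ℝ)..x, step s :=
    (integral_add_adjacent_intervals (step_intervalIntegrable _ _) (step_intervalIntegrable _ _)).symm
  have hsplit2 : ∫ s in (1 / 3 : ℝ)..x, step s =
      (∫ s in (1 / 3 : ℝ)..(2 / 3), step s) + ∫ s in (2 / 3 : ℝ)..x, step s :=
    (integral_add_adjacent_intervals (step_intervalIntegrable _ _) (step_intervalIntegrable _ _)).symm
  have h0 : ∫ s in (0 : ℝ)..(1 / 3), step s = 0 := stepRamp_of_le le_rfl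
  have h3 : ∫ s in (2 / 3 : ℝ)..x, step s = x - 2 / 3 := by
    have h : ∀ s ∈ uIcc (2 / 3 : ℝ) x, step s = 1 := by
      intro s hs
      rw [uIcc_of_le hx, mem_Icc] at hs
      exact step_of_ge hs.1
    rw [integral_congr (g := fun _ => (1 : ℝ)) h, intervalIntegral.integral_const, smul_eq_mul,
      mul_one]
  rw [hsplit1, hsplit2, h0, integral_step_transition, h3]
  ring

/-- The ramp is nondecreasing (its derivative is the nonnegative step). [folklore] -/
theorem stepRamp_monotone : Monotone stepRamp :=
  monotone_of_deriv_nonneg stepRamp_differentiable fun x => by rw [deriv_stepRamp]; exact step_nonneg x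

/-- The ramp is nonnegative. [folklore] -/
theorem stepRamp_nonneg (x : ℝ) : 0 ≤ stepRamp x := by
  rcases le_or_gt x (1 / 3) with h | h
  · rw [stepRamp_of_le h]
  · rw [← stepRamp_of_le (le_refl (1 / 3))]; exact stepRamp_monotone h.le

/-- **The ramp lies above its asymptote**: `x - 1/2 ≤ stepRamp x` (the difference has derivative
`step - 1 ≤ 0` and vanishes on `[2/3, ∞)`). [folklore] -/
theorem sub_half_le_stepRamp (x : ℝ) : x - 1 / 2 ≤ stepRamp x := by
  rcases le_or_gt (2 / 3) x with h | h
  · rw [stepRamp_of_ge h]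
  · -- `g s = stepRamp s - (s - 1/2)` is nonincreasing, and `g (2/3) = 0`
    have hanti : Antitone fun s => stepRamp s - (s - 1 / 2) := by
      apply antitone_of_deriv_nonpos
      · exact stepRamp_differentiable.sub ((differentiable_id).sub_const _)
      · intro s
        have hd : deriv (fun s => stepRamp s - (s - 1 / 2)) s = step s - 1 := by
          have h1 : HasDerivAt (fun s => stepRamp s - (s - 1 / 2)) (step s - 1) s :=
            (hasDerivAt_stepRamp s).sub ((hasDerivAt_id s).sub_const _)
          exact h1.deriv
        rw [hd]
        linarith [step_le_one s]
    have h23 : stepRamp (2 / 3) - (2 / 3 - 1 / 2) = 0 := by rw [stepRamp_of_ge le_rfl]; ring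
    have := hanti h.le
    simp only at this
    linarith

/-- The ramp is at most `max (x - 1/3) 0` — in particular `stepRamp x ≤ x` for `x ≥ 0` — since its
derivative is at most `1` and it vanishes at `1/3`. [folklore] -/
theorem stepRamp_le (x : ℝ) : stepRamp x ≤ max (x - 1 / 3) 0 := by
  rcases le_or_gt x (1 / 3) with h | h
  · rw [stepRamp_of_le h]; exact le_max_right _ _
  · have hmono : Monotone fun s => (s - 1 / 3) - stepRamp s := by
      apply monotone_of_deriv_nonneg
      · exact ((differentiable_id).sub_const _).sub stepRamp_differentiable
      · intro s
        have h1 : HasDerivAt (fun s => (s - 1 / 3) - stepRamp s) (1 - step s) s :=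
          ((hasDerivAt_id s).sub_const _).sub (hasDerivAt_stepRamp s)
        rw [h1.deriv]
        linarith [step_le_one s]
    have h13 : (1 / 3 - 1 / 3 : ℝ) - stepRamp (1 / 3) = 0 := by rw [stepRamp_of_le le_rfl]; ring
    have := hmono h.le
    simp only at this
    have : stepRamp x ≤ x - 1 / 3 := by linarith
    exact this.trans (le_max_left _ _)

/-! ## Scaled ramps, jog profiles and plateaus -/

/-- **Ramp at `a` with transition length `ρ`**: `rampAt a ρ x = ρ · stepRamp ((x - a)/ρ)`; for `ρ > 0`
it vanishes before `a + ρ/3` and equals `x - a - ρ/2` after `a + 2ρ/3`, with slope in `[0,1]`.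
[folklore] -/
def rampAt (a ρ : ℝ) (x : ℝ) : ℝ := ρ * stepRamp ((x - a) / ρ)

/-- Unfolding `rampAt`. [folklore] -/
theorem rampAt_apply (a ρ x : ℝ) : rampAt a ρ x = ρ * stepRamp ((x - a) / ρ) := rfl

/-- `rampAt` vanishes before the transition. [folklore] -/
theorem rampAt_of_le {a ρ x : ℝ} (hρ : 0 < ρ) (hx : x ≤ a + ρ / 3) : rampAt a ρ x = 0 := by
  rw [rampAt_apply, stepRamp_of_le, mul_zero]
  rw [div_le_iff₀ hρ]; linarith

/-- **`rampAt` is exactly affine after the transition**: `rampAt a ρ x = x - a - ρ/2` for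
`x ≥ a + 2ρ/3`. [folklore] -/
theorem rampAt_of_ge {a ρ x : ℝ} (hρ : 0 < ρ) (hx : a + 2 * ρ / 3 ≤ x) :
    rampAt a ρ x = x - a - ρ / 2 := by
  rw [rampAt_apply, stepRamp_of_ge]
  · have e : ρ * ((x - a) / ρ) = x - a := by field_simp
    rw [mul_sub, e]
    ring
  · rw [le_div_iff₀ hρ]; linarith

/-- The derivative of `rampAt a ρ` is the rescaled step `step ((x - a)/ρ) ∈ [0,1]`. [folklore] -/
theorem hasDerivAt_rampAt {a ρ : ℝ} (hρ : ρ ≠ 0) (x : ℝ) :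
    HasDerivAt (rampAt a ρ) (step ((x - a) / ρ)) x := by
  have h1 : HasDerivAt (fun y => (y - a) / ρ) (1 / ρ) x := by
    simpa using ((hasDerivAt_id x).sub_const a).div_const ρ
  have h2 : HasDerivAt (fun y => stepRamp ((y - a) / ρ)) (step ((x - a) / ρ) * (1 / ρ)) x :=
    (hasDerivAt_stepRamp _).comp x h1
  have h3 := h2.const_mul ρ
  have e : ρ * (step ((x - a) / ρ) * (1 / ρ)) = step ((x - a) / ρ) := by field_simp
  rw [e] at h3
  exact h3

/-- `rampAt a ρ` is smooth. [folklore] -/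
theorem rampAt_contDiff {a ρ : ℝ} {n : ℕ∞} : ContDiff ℝ n (rampAt a ρ) :=
  contDiff_const.mul (stepRamp_contDiff.comp ((contDiff_id.sub contDiff_const).div_const ρ))

/-- **Jog profile**: `jogProfile a b ρ = rampAt a ρ - rampAt b ρ` — for `ρ > 0` and
`a + 2ρ/3 ≤ b + ρ/3` it is `0` before `a + ρ/3`, affine of slope `1` (`= x - a - ρ/2`) on
`[a + 2ρ/3, b + ρ/3]`, and the constant `b - a` after `b + 2ρ/3`: a smooth monotone step of height
`b - a` with a straight middle part (the longitudinal profile of a born jog). [folklore] -/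
def jogProfile (a b ρ : ℝ) (x : ℝ) : ℝ := rampAt a ρ x - rampAt b ρ x

/-- Unfolding the jog profile. [folklore] -/
theorem jogProfile_apply (a b ρ x : ℝ) : jogProfile a b ρ x = rampAt a ρ x - rampAt b ρ x := rfl

/-- The jog profile vanishes before its first transition. [folklore] -/
theorem jogProfile_of_le {a b ρ x : ℝ} (hρ : 0 < ρ) (hab : a ≤ b) (hx : x ≤ a + ρ / 3) :
    jogProfile a b ρ x = 0 := by
  rw [jogProfile_apply, rampAt_of_le hρ hx, rampAt_of_le hρ (by linarith), sub_zero]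

/-- **The jog profile is exactly affine of slope `1` between its transitions.** [folklore] -/
theorem jogProfile_of_mem {a b ρ x : ℝ} (hρ : 0 < ρ) (h1 : a + 2 * ρ / 3 ≤ x) (h2 : x ≤ b + ρ / 3) :
    jogProfile a b ρ x = x - a - ρ / 2 := by
  rw [jogProfile_apply, rampAt_of_ge hρ h1, rampAt_of_le hρ h2, sub_zero]

/-- **The jog profile is exactly the constant `b - a` after its second transition.** [folklore] -/
theorem jogProfile_of_ge {a b ρ x : ℝ} (hρ : 0 < ρ) (hab : a ≤ b) (hx : b + 2 * ρ / 3 ≤ x) :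
    jogProfile a b ρ x = b - a := by
  rw [jogProfile_apply, rampAt_of_ge hρ (by linarith), rampAt_of_ge hρ hx]
  ring

/-- The jog profile is smooth. [folklore] -/
theorem jogProfile_contDiff {a b ρ : ℝ} {n : ℕ∞} : ContDiff ℝ n (jogProfile a b ρ) :=
  rampAt_contDiff.sub rampAt_contDiff

/-- The derivative of the jog profile is the difference of the two rescaled steps (in `[0,1]`
when the transitions are ordered, see `deriv_jogProfile_mem_Icc`). [folklore] -/
theorem hasDerivAt_jogProfile {a b ρ : ℝ} (hρ : ρ ≠ 0) (x : ℝ) :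
    HasDerivAt (jogProfile a b ρ) (step ((x - a) / ρ) - step ((x - b) / ρ)) x :=
  (hasDerivAt_rampAt hρ x).sub (hasDerivAt_rampAt hρ x)

/-- For ordered transitions (`a ≤ b`, `ρ > 0`) the slope of the jog profile lies in `[0,1]`.
[folklore] -/
theorem deriv_jogProfile_mem_Icc {a b ρ : ℝ} (hρ : 0 < ρ) (hab : a ≤ b) (x : ℝ) :
    deriv (jogProfile a b ρ) x ∈ Icc (0 : ℝ) 1 := by
  rw [(hasDerivAt_jogProfile hρ.ne' x).deriv]
  have hmono : step ((x - b) / ρ) ≤ step ((x - a) / ρ) :=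
    step_monotone (div_le_div_of_nonneg_right (by linarith) hρ.le)
  exact ⟨by linarith, by linarith [step_le_one ((x - a) / ρ), step_nonneg ((x - b) / ρ)]⟩

/-- **Plateau cut-off** on `[a, b]` with transition length `ρ`:
`plateau a b ρ x = step ((x - a)/ρ) · step ((b - x)/ρ)`; for `ρ > 0` it is `1` on
`[a + 2ρ/3, b - 2ρ/3]`, `0` off `(a + ρ/3, b - ρ/3)`, with values in `[0,1]`. [folklore] -/
def plateau (a b ρ : ℝ) (x : ℝ) : ℝ := step ((x - a) / ρ) * step ((b - x) / ρ)

/-- Unfolding the plateau. [folklore] -/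
theorem plateau_apply (a b ρ x : ℝ) : plateau a b ρ x = step ((x - a) / ρ) * step ((b - x) / ρ) := rfl

/-- **The plateau is `1` on its core** `[a + 2ρ/3, b - 2ρ/3]`. [folklore] -/
theorem plateau_of_mem {a b ρ x : ℝ} (hρ : 0 < ρ) (h1 : a + 2 * ρ / 3 ≤ x) (h2 : x ≤ b - 2 * ρ / 3) :
    plateau a b ρ x = 1 := by
  rw [plateau_apply, step_of_ge, step_of_ge, mul_one]
  · rw [le_div_iff₀ hρ]; linarith
  · rw [le_div_iff₀ hρ]; linarith

/-- The plateau vanishes to the left of `a + ρ/3`. [folklore] -/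
theorem plateau_of_le_left {a b ρ x : ℝ} (hρ : 0 < ρ) (hx : x ≤ a + ρ / 3) : plateau a b ρ x = 0 := by
  rw [plateau_apply, step_of_le, zero_mul]
  rw [div_le_iff₀ hρ]; linarith

/-- The plateau vanishes to the right of `b - ρ/3`. [folklore] -/
theorem plateau_of_ge_right {a b ρ x : ℝ} (hρ : 0 < ρ) (hx : b - ρ / 3 ≤ x) : plateau a b ρ x = 0 := by
  rw [plateau_apply, step_of_le (x := (b - x) / ρ), mul_zero]
  rw [div_le_iff₀ hρ]; linarith

/-- The plateau takes values in `[0,1]`. [folklore] -/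
theorem plateau_mem_Icc (a b ρ x : ℝ) : plateau a b ρ x ∈ Icc (0 : ℝ) 1 := by
  rw [plateau_apply]
  exact ⟨mul_nonneg (step_nonneg _) (step_nonneg _),
    mul_le_one₀ (step_le_one _) (step_nonneg _) (step_le_one _)⟩

/-- The plateau is smooth. [folklore] -/
theorem plateau_contDiff {a b ρ : ℝ} {n : ℕ∞} : ContDiff ℝ n (plateau a b ρ) :=
  (step_contDiff.comp ((contDiff_id.sub contDiff_const).div_const ρ)).mul
    (step_contDiff.comp ((contDiff_const.sub contDiff_id).div_const ρ))

/-- **Plateaus localise**: a function multiplied by a plateau agrees with it on the core and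
vanishes off the support — the two facts used when a move is cut off transversally. [folklore] -/
theorem plateau_mul_eq {a b ρ x : ℝ} (f : ℝ → ℝ) (hρ : 0 < ρ) (h1 : a + 2 * ρ / 3 ≤ x)
    (h2 : x ≤ b - 2 * ρ / 3) : plateau a b ρ x * f x = f x := by
  rw [plateau_of_mem hρ h1 h2, one_mul]

/-- Off the support the cut-off product vanishes. [folklore] -/
theorem plateau_mul_eq_zero {a b ρ x : ℝ} (f : ℝ → ℝ) (hρ : 0 < ρ)
    (hx : x ≤ a + ρ / 3 ∨ b - ρ / 3 ≤ x) : plateau a b ρ x * f x = 0 := by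
  rcases hx with hx | hx
  · rw [plateau_of_le_left hρ hx, zero_mul]
  · rw [plateau_of_ge_right hρ hx, zero_mul]

end Literature.Analysis.FluidPDE.Gluing
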